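import Literature.MathematicalPhysics.QuantumFieldTheory.WilsonFinTorusSpectralData
import Literature.Dynamics.Contraction.HopfIntegralOperatorSpectralRatio
import HarnessLib

/-!
# Hopf's spectral bound for the transfer matrix of an ANISOTROPIC spatial box `b₁ × b₂ × b₃`:
# `λᵢ ≤ tanh(3Nβ·b₁b₂b₃)·λ₀` (`i ≠ i₀`), and the explicit decay of the thermal excess
# `Z(b₁×b₂×b₃×(m+2)) − λ₀^{m+2} ≤ tanh(3Nβ·b₁b₂b₃)^m·λ₀^m·(Z(b₁×b₂×b₃×2) − λ₀²)`

Topic `Literature/MathematicalPhysics/QuantumFieldTheory`; part 4 of the `Fin`-box transfer-matrix chain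
(`WilsonFinTorusSliceKernel.lean`, `WilsonFinTorusSliceChain.lean`, `WilsonFinTorusSpectralData.lean`), the anisotropic
twin of `WilsonTorusTransferGapExplicit.lean` (cubic torus, `TransferGap` currency).  THEOREMS ONLY (no definition, no
named fact).

THE ARGUMENT is the one of the cubic file, verbatim for the box: the temporal plaquette energy of one slab satisfies
`0 ≤ S_tm ≤ 6N·b₁b₂b₃` (`3·b₁b₂b₃` temporal plaquettes, each `N − Re tr ρ(·) ∈ [0, 2N]`), so the Gauss-law factor
`∫ e^{−βS_tm} dg ∈ [e^{−6Nβ·b₁b₂b₃}, 1]` and the half-weights `e^{−βS_sp∕2}` cancel in the cross-ratios of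
`K = finTorusSliceKernel ρ β`: `K(a,b)K(a',b') ≤ e^{12Nβ·b₁b₂b₃}·K(a,b')K(a',b)` (`finTorusSliceKernel_crossRatio_le`) —
Eveson–Nussbaum's projective diameter `Δ ≤ 12Nβ·b₁b₂b₃` [EvesonNussbaum1995, Thm 6.3 (11) p. 52].  Hopf's inequality for
integral operators [Hopf1963, Thm 4; AnseloneLee1974, Thm 6.2] (tree `abs_eigenvalue_le_tanh_mul_of_kernel_of_inner_eq_zero`)
then gives, for ANY bounded operator `A` on `L²` of the spatial links with the kernel formula `Aφ =ᵐ ∫K(·,y)φ(y)` (the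
shape delivered by `exists_eigenbasis_finTorusSliceKernel` ∕ `exists_kernelOp`) and any Hilbert basis of eigenvectors
`A bᵢ = λᵢ bᵢ` with `λ_{i₀} = ‖A‖`: `|λᵢ| ≤ tanh(3Nβ·b₁b₂b₃)·‖A‖` for every `i ≠ i₀` (`abs_eigenvalue_le_tanh_mul`).
Packaged with the trace formula (`exists_spectralData_hopf_box`): eigenvalues `0 ≤ λᵢ ≤ λ_{i₀}`, `0 < λ_{i₀}`, `Σλᵢ² < ∞`,
`Z(m+2) = Σᵢ λᵢ^{m+2}`, AND `λᵢ ≤ τ·λ_{i₀}` (`i ≠ i₀`, `τ = tanh(3Nβ·b₁b₂b₃)`), whence the explicit geometric decay of the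
thermal excess in the time extent: `Z(m+2) ≤ λ₀^{m+2} + τ^m·λ₀^m·(Z(2) − λ₀²)`.

HONEST FRAMING.  Explicit but VOLUME-DEPENDENT: `τ = tanh(3Nβ·b₁b₂b₃) → 1` exponentially fast in the spatial volume, so
the rate `−log τ ≥ e^{−6Nβ·b₁b₂b₃}` says nothing volume-uniform; a located finite-volume mechanism (census B6,
«Birkhoff–Hopf cone contraction, osc = O(β·L³)»), NOT a mass gap, no bearing on `BalabanLadder.IR` ∕ `IRcof` ∕ THE NUMBER.
The Yang–Mills mass gap (Clay) is NOT proved by any of this; R4 closes only the conditional finite-𝕋⁴ rung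
`BalabanLadder.UV`.  No `def`, no `instance`, no `sorry`; standard axioms.

## References
* [Hopf1963] E. Hopf, *An inequality for positive linear integral operators*, J. Math. Mech. 12 (1963) 683–692, Thm 4.
* [AnseloneLee1974] P. M. Anselone, J. W. Lee, Linear Algebra Appl. 9 (1974) 67–87, §6, Thm 6.2.
* [EvesonNussbaum1995] S. P. Eveson, R. D. Nussbaum, Math. Proc. Camb. Phil. Soc. 117 (1995) 31–55, Thm 6.3 (10)–(11) pp. 52–53.
* [MontvayMunster1994] I. Montvay, G. Münster, *Quantum Fields on a Lattice*, §3.2.6 (3.140)–(3.146).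
* [ReedSimonI1980] Thm VI.16, VI.22–23 (Hilbert–Schmidt); [ReedSimonIV1978] Thm XIII.43–44 (Jentzsch).
-/

noncomputable section

open scoped BigOperators Topology InnerProductSpace ENNReal
open MeasureTheory Filter Function Real
open Literature.Barriers.QuantumFields Literature.Analysis.OperatorTheory Literature.Dynamics.Contraction.BirkhoffHopf

namespace Literature.MathematicalPhysics.QuantumFieldTheory

namespace WilsonFinTorusHopf

/-! ## §1 The temporal plaquette energy of a slab is at most `6N·b₁b₂b₃` -/

section Energy

variable {b₁ b₂ b₃ : ℕ} {G : Type*} [Group G] {N : ℕ} (ρ : G →* Matrix (Fin N) (Fin N) ℂ)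

/-- `#FinSpatialSite b₁ b₂ b₃ = b₁b₂b₃` (plumbing). [folklore] -/
private theorem card_finSpatialSite : Fintype.card (FinSpatialSite b₁ b₂ b₃) = b₁ * (b₂ * b₃) := by
  rw [Fintype.card_prod, Fintype.card_prod, Fintype.card_fin, Fintype.card_fin, Fintype.card_fin]

/-- **`S_tm ≥ 0`** for unitary `ρ` (each temporal plaquette term `N − Re tr ρ(U_P) ≥ 0`).
[cite: MontvayMunster1994, §3.2.2 (3.67) and §3.2.6 (3.141)] -/
theorem finTorusTemporalAction_nonneg (hρu : ∀ g, ρ g ∈ Matrix.unitaryGroup (Fin N) ℂ)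
    (a : FinSpatialSite b₁ b₂ b₃ × Fin 3 → G) (g : FinSpatialSite b₁ b₂ b₃ → G)
    (b : FinSpatialSite b₁ b₂ b₃ × Fin 3 → G) : 0 ≤ finTorusTemporalAction ρ a g b :=
  Finset.sum_nonneg fun _ _ => Finset.sum_nonneg fun _ _ => sub_nonneg.2 ((Complex.re_le_norm _).trans
    (FiniteTemperature.norm_trace_le_of_mem_unitaryGroup (hρu _)))

/-- **`S_tm ≤ 6N·b₁b₂b₃`** for unitary `ρ`: `3·b₁b₂b₃` temporal plaquettes, each term `N − Re tr ρ(U_P) ≤ 2N`.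
[cite: MontvayMunster1994, §3.2.6 (3.141)] -/
theorem finTorusTemporalAction_le (hρu : ∀ g, ρ g ∈ Matrix.unitaryGroup (Fin N) ℂ)
    (a : FinSpatialSite b₁ b₂ b₃ × Fin 3 → G) (g : FinSpatialSite b₁ b₂ b₃ → G)
    (b : FinSpatialSite b₁ b₂ b₃ × Fin 3 → G) :
    finTorusTemporalAction ρ a g b ≤ 6 * N * ((b₁ : ℝ) * b₂ * b₃) := by
  unfold finTorusTemporalAction
  calc ∑ p : FinSpatialSite b₁ b₂ b₃, ∑ i : Fin 3,
        ((N : ℝ) - (ρ (a (p, i) * g (p.shift i) * (b (p, i))⁻¹ * (g p)⁻¹)).trace.re)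
      ≤ ∑ _p : FinSpatialSite b₁ b₂ b₃, ∑ _i : Fin 3, (2 * N : ℝ) := by
        refine Finset.sum_le_sum fun p _ => Finset.sum_le_sum fun i _ => ?_
        have h1 := Complex.abs_re_le_norm (ρ (a (p, i) * g (p.shift i) * (b (p, i))⁻¹ * (g p)⁻¹)).trace
        have h2 := FiniteTemperature.norm_trace_le_of_mem_unitaryGroup
          (hρu (a (p, i) * g (p.shift i) * (b (p, i))⁻¹ * (g p)⁻¹))
        rw [abs_le] at h1
        linarith [h1.1]
    _ = 6 * N * ((b₁ : ℝ) * b₂ * b₃) := by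
        rw [Finset.sum_const, Finset.sum_const, Finset.card_univ, Finset.card_univ, Fintype.card_fin,
          card_finSpatialSite]
        simp only [nsmul_eq_mul]
        push_cast
        ring

end Energy

/-! ## §2 The cross-ratio diameter of the box kernel is at most `12Nβ·b₁b₂b₃` -/

section CrossRatio

variable {b₁ b₂ b₃ : ℕ} {G : Type*} [Group G] [TopologicalSpace G] [IsTopologicalGroup G] [CompactSpace G]
  [MeasurableSpace G] [BorelSpace G] {N : ℕ} (ρ : G →* Matrix (Fin N) (Fin N) ℂ)

/-- The algebra of the cancellation of the half-weights in the cross-ratio (plumbing). [folklore] -/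
private theorem crossRatio_aux {aU aV aU' aV' I₁ I₂ I₃ I₄ E : ℝ} (haU : 0 ≤ aU) (haV : 0 ≤ aV) (haU' : 0 ≤ aU')
    (haV' : 0 ≤ aV') (h12 : I₁ * I₂ ≤ 1) (h34 : 1 ≤ E * (I₃ * I₄)) :
    aU * I₁ * aV * (aU' * I₂ * aV') ≤ E * (aU * I₃ * aV' * (aU' * I₄ * aV)) := by
  have hP : 0 ≤ aU * aV * aU' * aV' := by positivity
  calc aU * I₁ * aV * (aU' * I₂ * aV') = (aU * aV * aU' * aV') * (I₁ * I₂) := by ring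
    _ ≤ (aU * aV * aU' * aV') * 1 := mul_le_mul_of_nonneg_left h12 hP
    _ ≤ (aU * aV * aU' * aV') * (E * (I₃ * I₄)) := mul_le_mul_of_nonneg_left h34 hP
    _ = E * (aU * I₃ * aV' * (aU' * I₄ * aV)) := by ring

variable [SecondCountableTopology G]

/-- **The Gauss-law factor of the box is between `e^{−6Nβ·b₁b₂b₃}` and `1`** (`β ≥ 0`, continuous unitary `ρ`).
[cite: MontvayMunster1994, §3.2.6 (3.144)] -/
theorem exp_neg_le_integral_exp_neg_finTorusTemporalAction_le (hρ : Continuous ρ)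
    (hρu : ∀ g, ρ g ∈ Matrix.unitaryGroup (Fin N) ℂ) {β : ℝ} (hβ : 0 ≤ β)
    (a b : FinSpatialSite b₁ b₂ b₃ × Fin 3 → G) :
    Real.exp (-(β * (6 * N * ((b₁ : ℝ) * b₂ * b₃)))) ≤
        ∫ g, Real.exp (-(β * finTorusTemporalAction ρ a g b))
          ∂(Measure.pi fun _ : FinSpatialSite b₁ b₂ b₃ => haarProbability G) ∧
      ∫ g, Real.exp (-(β * finTorusTemporalAction ρ a g b))
          ∂(Measure.pi fun _ : FinSpatialSite b₁ b₂ b₃ => haarProbability G) ≤ 1 := by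
  have hcont : Continuous fun g : FinSpatialSite b₁ b₂ b₃ → G => Real.exp (-(β * finTorusTemporalAction ρ a g b)) :=
    Real.continuous_exp.comp ((continuous_const.mul ((continuous_finTorusTemporalAction ρ hρ).comp
      (continuous_const.prodMk (continuous_id.prodMk continuous_const)))).neg)
  have hint : Integrable (fun g : FinSpatialSite b₁ b₂ b₃ → G => Real.exp (-(β * finTorusTemporalAction ρ a g b)))
      (Measure.pi fun _ : FinSpatialSite b₁ b₂ b₃ => haarProbability G) :=
    integrable_of_abs_le_one hcont.measurable fun g =>
      (Real.abs_exp _).trans_le (exp_neg_finTorusTemporalAction_le_one ρ hρu hβ a g b)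
  refine ⟨?_, (le_abs_self _).trans (abs_integral_le_one fun g =>
    (Real.abs_exp _).trans_le (exp_neg_finTorusTemporalAction_le_one ρ hρu hβ a g b))⟩
  have hc : ∫ _g : FinSpatialSite b₁ b₂ b₃ → G, Real.exp (-(β * (6 * N * ((b₁ : ℝ) * b₂ * b₃))))
      ∂(Measure.pi fun _ : FinSpatialSite b₁ b₂ b₃ => haarProbability G) =
        Real.exp (-(β * (6 * N * ((b₁ : ℝ) * b₂ * b₃)))) := by
    simp
  rw [← hc]
  exact integral_mono (integrable_const _) hint fun g => Real.exp_le_exp.2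
    (neg_le_neg (mul_le_mul_of_nonneg_left (finTorusTemporalAction_le ρ hρu a g b) hβ))

/-- **THE CROSS-RATIO DIAMETER OF THE BOX KERNEL IS AT MOST `12Nβ·b₁b₂b₃`**: for `β ≥ 0`, continuous unitary `ρ`, and all
slices `a, a', b, b'`: `K(a,b)·K(a',b') ≤ e^{12Nβ·b₁b₂b₃}·K(a,b')·K(a',b)`, `K = finTorusSliceKernel ρ β`.
[cite: EvesonNussbaum1995, Thm 6.3 (11) p. 52 and Remark 6.4 p. 53; MontvayMunster1994, §3.2.6 (3.144)] -/
theorem finTorusSliceKernel_crossRatio_le (hρ : Continuous ρ) (hρu : ∀ g, ρ g ∈ Matrix.unitaryGroup (Fin N) ℂ)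
    {β : ℝ} (hβ : 0 ≤ β) (a a' b b' : FinSpatialSite b₁ b₂ b₃ × Fin 3 → G) :
    finTorusSliceKernel ρ β a b * finTorusSliceKernel ρ β a' b' ≤
      Real.exp (12 * N * β * ((b₁ : ℝ) * b₂ * b₃)) * (finTorusSliceKernel ρ β a b' * finTorusSliceKernel ρ β a' b) := by
  have hI := fun a b => exp_neg_le_integral_exp_neg_finTorusTemporalAction_le (b₁ := b₁) (b₂ := b₂) (b₃ := b₃)
    ρ hρ hρu hβ a b
  unfold finTorusSliceKernel
  refine crossRatio_aux (Real.exp_pos _).le (Real.exp_pos _).le (Real.exp_pos _).le (Real.exp_pos _).le ?_ ?_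
  · exact mul_le_one₀ (hI a b).2 (integral_nonneg fun g => (Real.exp_pos _).le) (hI a' b').2
  · have h0 : 0 < Real.exp (-(β * (6 * N * ((b₁ : ℝ) * b₂ * b₃)))) := Real.exp_pos _
    calc (1 : ℝ) = Real.exp (12 * N * β * ((b₁ : ℝ) * b₂ * b₃)) *
          (Real.exp (-(β * (6 * N * ((b₁ : ℝ) * b₂ * b₃)))) * Real.exp (-(β * (6 * N * ((b₁ : ℝ) * b₂ * b₃))))) := by
          rw [← Real.exp_add, ← Real.exp_add, eq_comm, Real.exp_eq_one_iff]; ring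
      _ ≤ Real.exp (12 * N * β * ((b₁ : ℝ) * b₂ * b₃)) *
          ((∫ g, Real.exp (-(β * finTorusTemporalAction ρ a g b'))
              ∂(Measure.pi fun _ : FinSpatialSite b₁ b₂ b₃ => haarProbability G)) *
           ∫ g, Real.exp (-(β * finTorusTemporalAction ρ a' g b))
              ∂(Measure.pi fun _ : FinSpatialSite b₁ b₂ b₃ => haarProbability G)) :=
          mul_le_mul_of_nonneg_left (mul_le_mul (hI a b').1 (hI a' b).1 h0.le
            (integral_nonneg fun g => (Real.exp_pos _).le)) (Real.exp_pos _).le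

end CrossRatio

/-! ## §3 Hopf's bound on the spectrum of the box transfer operator -/

section Spectral

variable {b₁ b₂ b₃ : ℕ} {G : Type*} [Group G] [TopologicalSpace G] [IsTopologicalGroup G] [CompactSpace G]
  [MeasurableSpace G] [BorelSpace G] [SecondCountableTopology G] {N : ℕ} (ρ : G →* Matrix (Fin N) (Fin N) ℂ)

/-- `tanh x ≥ 0` for `x ≥ 0` (plumbing). [folklore] -/
private theorem tanh_nonneg' {x : ℝ} (hx : 0 ≤ x) : 0 ≤ Real.tanh x := by
  have h := tanh_quarter_nonneg (Δ := 4 * x) (by linarith)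
  rwa [show (4 * x) / 4 = x by ring] at h

/-- **HOPF's BOUND ON THE SPECTRUM OF THE BOX TRANSFER OPERATOR.**  `β ≥ 0`, continuous unitary `ρ`, spatial box
`b₁ × b₂ × b₃`.  For ANY bounded operator `A` on `L²` of the spatial links with the kernel formula
`Aφ =ᵐ ∫ finTorusSliceKernel ρ β (·) y · φ y` (as delivered by `exists_eigenbasis_finTorusSliceKernel` ∕ `exists_kernelOp`),
any Hilbert basis `b` of eigenvectors `A bᵢ = λᵢ bᵢ` and any `i₀` with `λ_{i₀} = ‖A‖`: every other eigenvalue satisfies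
`|λᵢ| ≤ tanh(3Nβ·b₁b₂b₃)·‖A‖`.  (`A` is compact, self-adjoint, positivity improving, non-zero from the kernel; the top
eigenspace is the Jentzsch line of `φ > 0`; `bᵢ ⊥ φ` for `i ≠ i₀`; Hopf with `Δ = 12Nβ·b₁b₂b₃`.)
[cite: Hopf1963, Thm 4; AnseloneLee1974, Thm 6.2; EvesonNussbaum1995, Thm 6.3 pp. 52–53 and p. 32; MontvayMunster1994, §3.2.6 (3.144)–(3.146)] -/
theorem abs_eigenvalue_le_tanh_mul (hρ : Continuous ρ) (hρu : ∀ g, ρ g ∈ Matrix.unitaryGroup (Fin N) ℂ)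
    {β : ℝ} (hβ : 0 ≤ β)
    {A : Lp ℝ 2 (Measure.pi fun _ : FinSpatialSite b₁ b₂ b₃ × Fin 3 => haarProbability G) →L[ℝ]
      Lp ℝ 2 (Measure.pi fun _ : FinSpatialSite b₁ b₂ b₃ × Fin 3 => haarProbability G)}
    (hA : ∀ φ : Lp ℝ 2 (Measure.pi fun _ : FinSpatialSite b₁ b₂ b₃ × Fin 3 => haarProbability G),
      (A φ : (FinSpatialSite b₁ b₂ b₃ × Fin 3 → G) → ℝ)
        =ᵐ[Measure.pi fun _ : FinSpatialSite b₁ b₂ b₃ × Fin 3 => haarProbability G] fun x =>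
          ∫ y, finTorusSliceKernel ρ β x y * φ y ∂(Measure.pi fun _ : FinSpatialSite b₁ b₂ b₃ × Fin 3 => haarProbability G))
    {ι : Type*} (b : HilbertBasis ι ℝ (Lp ℝ 2 (Measure.pi fun _ : FinSpatialSite b₁ b₂ b₃ × Fin 3 => haarProbability G)))
    {lam : ι → ℝ} (hb : ∀ i, A (b i) = lam i • b i) {i₀ : ι} (hi₀ : lam i₀ = ‖A‖) {i : ι} (hi : i ≠ i₀) :
    |lam i| ≤ Real.tanh (3 * N * β * ((b₁ : ℝ) * b₂ * b₃)) * ‖A‖ := by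
  have hKm := stronglyMeasurable_uncurry_finTorusSliceKernel (b₁ := b₁) (b₂ := b₂) (b₃ := b₃) ρ hρ β
  obtain ⟨C, hC⟩ := exists_norm_finTorusSliceKernel_le (b₁ := b₁) (b₂ := b₂) (b₃ := b₃) ρ hρ β
  have hsymm := finTorusSliceKernel_symm (b₁ := b₁) (b₂ := b₂) (b₃ := b₃) ρ hρu β
  have hK := finTorusSliceKernel_pos (b₁ := b₁) (b₂ := b₂) (b₃ := b₃) ρ hρ β
  have hC0 : 0 ≤ C := (norm_nonneg _).trans (hC 1 1)
  have hsa : IsSelfAdjoint A := isSelfAdjoint_kernelOp hKm hC hsymm hA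
  have hc : IsCompactOperator A := isCompactOperator_kernelOp hC hC0 hA
  have himp : IsPositivityImproving A := isPositivityImproving_kernelOp hKm hC hK hA
  have h0 : A ≠ 0 := kernelOp_ne_zero hKm hC hK (IsProbabilityMeasure.ne_zero _) hA
  obtain ⟨φ, hφ1, hφpos, hAφ, huniq, -⟩ := himp.exists_spectralGap hsa hc h0
  have hφ0 : φ ≠ 0 := by rw [← norm_ne_zero_iff, hφ1]; exact one_ne_zero
  have hφP : IsPositiveFun φ := hφpos.isPositiveFun (measure_ne_zero_of_ne_zero hφ0)
  -- the top basis vector is on the Jentzsch line, so the others are orthogonal to `φ`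
  have hbi₀ : b i₀ = ⟪φ, b i₀⟫_ℝ • φ := huniq _ (by rw [hb, hi₀])
  set c₀ : ℝ := ⟪φ, b i₀⟫_ℝ with hc₀_def
  have hc₀ : c₀ ≠ 0 := fun h => by
    have h1 := hbi₀
    rw [h, zero_smul] at h1
    exact b.orthonormal.ne_zero i₀ h1
  have horth : ⟪φ, b i⟫_ℝ = 0 := by
    have hφeq : φ = c₀⁻¹ • b i₀ := by rw [hbi₀, smul_smul, inv_mul_cancel₀ hc₀, one_smul]
    rw [hφeq, real_inner_smul_left, b.orthonormal.2 hi.symm, mul_zero]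
  have hΔ : ∀ a a' b' b'' : FinSpatialSite b₁ b₂ b₃ × Fin 3 → G,
      finTorusSliceKernel ρ β a b' * finTorusSliceKernel ρ β a' b'' ≤
        Real.exp (12 * N * β * ((b₁ : ℝ) * b₂ * b₃)) *
          (finTorusSliceKernel ρ β a b'' * finTorusSliceKernel ρ β a' b') :=
    finTorusSliceKernel_crossRatio_le ρ hρ hρu hβ
  have h := abs_eigenvalue_le_tanh_mul_of_kernel_of_inner_eq_zero hKm hC hK hΔ hA hφP hAφ (hb i)
    (b.orthonormal.ne_zero i) horth
  rwa [show (12 * N * β * ((b₁ : ℝ) * b₂ * b₃)) / 4 = 3 * N * β * ((b₁ : ℝ) * b₂ * b₃) by ring] at h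

/-- **SPECTRAL DATA OF THE BOX WITH HOPF's RATIO BOUND AND THE EXPLICIT DECAY OF THE THERMAL EXCESS.**  `β ≥ 0`, continuous
unitary `ρ`, every `b₁, b₂, b₃`: there are a countable index set, eigenvalues `0 ≤ λᵢ ≤ λ_{i₀}`, `0 < λ_{i₀}`, `Σλᵢ² < ∞`,
with the trace formula `Z(b₁×b₂×b₃×(m+2)) = Σᵢ λᵢ^{m+2}` (as in `exists_spectralData_wilsonFinTorusPartition_box`), AND:
(Hopf) `λᵢ ≤ τ·λ_{i₀}` for all `i ≠ i₀`, `τ = tanh(3Nβ·b₁b₂b₃)`; (decay) for every `m`,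
`Z(m+2) ≤ λ_{i₀}^{m+2} + τ^m·λ_{i₀}^m·(Z(2) − λ_{i₀}²)` — the thermal excess `Z(m+2)∕λ₀^{m+2} − 1` of the cold box decays
at least like `τ^m`, an explicit (volume-dependent) rate.
[cite: Hopf1963, Thm 4; EvesonNussbaum1995, Thm 6.3 and p. 32; MontvayMunster1994, §1.5.2 (1.196) and §3.2.6 (3.145); ReedSimonI1980, Thm VI.16 and VI.22–23] -/
theorem exists_spectralData_hopf_box (hρ : Continuous ρ) (hρu : ∀ g, ρ g ∈ Matrix.unitaryGroup (Fin N) ℂ)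
    {β : ℝ} (hβ : 0 ≤ β) (b₁ b₂ b₃ : ℕ) :
    ∃ (s : Set (Lp ℝ 2 (Measure.pi fun _ : FinSpatialSite b₁ b₂ b₃ × Fin 3 => haarProbability G)))
      (_ : Countable s) (lam : s → ℝ) (i₀ : s),
      (∀ i, 0 ≤ lam i ∧ lam i ≤ lam i₀) ∧ 0 < lam i₀ ∧ Summable (fun i => lam i ^ 2) ∧
      (∀ m : ℕ, HasSum (fun i => lam i ^ (m + 2)) (wilsonFinTorusPartition ρ β b₁ b₂ b₃ (m + 2))) ∧
      (∀ i, i ≠ i₀ → lam i ≤ Real.tanh (3 * N * β * ((b₁ : ℝ) * b₂ * b₃)) * lam i₀) ∧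
      ∀ m : ℕ, wilsonFinTorusPartition ρ β b₁ b₂ b₃ (m + 2) ≤
        lam i₀ ^ (m + 2) + Real.tanh (3 * N * β * ((b₁ : ℝ) * b₂ * b₃)) ^ m * lam i₀ ^ m *
          (wilsonFinTorusPartition ρ β b₁ b₂ b₃ 2 - lam i₀ ^ 2) := by
  classical
  set μ : Measure (FinSpatialSite b₁ b₂ b₃ × Fin 3 → G) :=
    Measure.pi fun _ : FinSpatialSite b₁ b₂ b₃ × Fin 3 => haarProbability G with hμ
  set K : (FinSpatialSite b₁ b₂ b₃ × Fin 3 → G) → (FinSpatialSite b₁ b₂ b₃ × Fin 3 → G) → ℝ :=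
    finTorusSliceKernel ρ β with hKdef
  set τ : ℝ := Real.tanh (3 * N * β * ((b₁ : ℝ) * b₂ * b₃)) with hτ
  have hτ0 : 0 ≤ τ := tanh_nonneg' (by positivity)
  have hK : StronglyMeasurable (uncurry K) := stronglyMeasurable_uncurry_finTorusSliceKernel ρ hρ β
  obtain ⟨C, hC⟩ := exists_norm_finTorusSliceKernel_le (b₁ := b₁) (b₂ := b₂) (b₃ := b₃) ρ hρ β
  have hsymm : ∀ x y, K x y = K y x := finTorusSliceKernel_symm ρ hρu β
  have hKpos : ∀ x y, 0 < K x y := finTorusSliceKernel_pos ρ hρ β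
  -- the transfer operator on `L²` of the spatial links
  obtain ⟨A, hA⟩ := exists_kernelOp (μ := μ) hK hC
  have hsa : IsSelfAdjoint A := isSelfAdjoint_kernelOp hK hC hsymm hA
  have hC0 : 0 ≤ C := (norm_nonneg _).trans (hC 1 1)
  have hcpt : IsCompactOperator A := isCompactOperator_kernelOp hC hC0 hA
  have himp : IsPositivityImproving A := isPositivityImproving_kernelOp hK hC hKpos hA
  have hA0 : A ≠ 0 := kernelOp_ne_zero hK hC hKpos (IsProbabilityMeasure.ne_zero _) hA
  -- an eigenbasis (Hilbert–Schmidt theorem), countable by separability of `L²`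
  obtain ⟨s, b, lam, hbs, hb0⟩ := exists_hilbertBasis_eigenvectors_of_isSelfAdjoint hcpt hsa
  have hb : ∀ i, A (b i) = lam i • b i := fun i => by simpa using hb0 i
  haveI : Fact ((2 : ℝ≥0∞) ≠ ⊤) := ⟨ENNReal.ofNat_ne_top⟩
  have hon : Orthonormal ℝ ((↑) : s → Lp ℝ 2 μ) := hbs ▸ b.orthonormal
  have hcnt : Countable s := (hon.countable_of_separableSpace (𝕜 := ℝ)).to_subtype
  haveI : Countable s := hcnt
  -- non-negative eigenvalues (Lüscher), top eigenvalue `λ_{i₀} = ‖A‖ > 0` (Jentzsch), `Σ λ² < ∞`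
  have hlam0 : ∀ i, 0 ≤ lam i := fun i => by
    rw [lam_eq_inner hb i]
    exact inner_kernelOp_self_nonneg hA (posType_finTorusSliceKernel ρ hρ hρu hβ) _
  obtain ⟨ψ, hψ0, hψ⟩ := himp.exists_top_eigenvector_of_isCompactOperator hsa hcpt hA0
  obtain ⟨i₀, hi₀⟩ := exists_index_eq_norm b hsa hb hψ0 hψ
  have hle : ∀ i, lam i ≤ lam i₀ := fun i => (le_abs_self _).trans ((abs_lam_le_norm hb i).trans hi₀.ge)
  have hL0 : 0 < lam i₀ := by rw [hi₀]; exact norm_pos_iff.2 hA0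
  have hS := hasSum_lam_sq hK hC hA hb
  -- the trace formula
  have hZ : ∀ m : ℕ, HasSum (fun i => lam i ^ (m + 2)) (wilsonFinTorusPartition ρ β b₁ b₂ b₃ (m + 2)) := fun m => by
    rw [wilsonFinTorusPartition_eq_integral_prod_finTorusSliceKernel_succ ρ hρ β b₁ b₂ b₃ m]
    exact hasSum_pow_integral_cyclic hK hC hsymm hA hb hlam0 m
  -- Hopf's ratio bound
  have hHopf : ∀ i, i ≠ i₀ → lam i ≤ τ * lam i₀ := fun i hi => by
    have h := abs_eigenvalue_le_tanh_mul (b₁ := b₁) (b₂ := b₂) (b₃ := b₃) ρ hρ hρu hβ hA b hb hi₀ hi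
    rw [← hi₀] at h
    exact (le_abs_self _).trans h
  -- the decay of the thermal excess
  have hdecay : ∀ m : ℕ, wilsonFinTorusPartition ρ β b₁ b₂ b₃ (m + 2) ≤
      lam i₀ ^ (m + 2) + τ ^ m * lam i₀ ^ m * (wilsonFinTorusPartition ρ β b₁ b₂ b₃ 2 - lam i₀ ^ 2) := by
    intro m
    set g : s → ℝ := fun i => τ ^ m * lam i₀ ^ m * lam i ^ 2 with hg
    have hgsum : HasSum g (τ ^ m * lam i₀ ^ m * wilsonFinTorusPartition ρ β b₁ b₂ b₃ 2) := by
      have h2 := hZ 0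
      simp only [Nat.zero_add] at h2
      exact h2.mul_left _
    have hupd := hgsum.update i₀ (lam i₀ ^ (m + 2))
    refine hasSum_le (fun i => ?_) (hZ m) hupd |>.trans (le_of_eq ?_)
    · by_cases hii : i = i₀
      · subst hii; rw [update_self]
      · rw [update_of_ne hii, hg]
        have hr : lam i ≤ τ * lam i₀ := hHopf i hii
        calc lam i ^ (m + 2) = lam i ^ m * lam i ^ 2 := by ring
          _ ≤ (τ * lam i₀) ^ m * lam i ^ 2 :=
              mul_le_mul_of_nonneg_right (pow_le_pow_left₀ (hlam0 i) hr m) (sq_nonneg _)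
          _ = τ ^ m * lam i₀ ^ m * lam i ^ 2 := by rw [mul_pow]
    · simp only [hg]; ring
  exact ⟨s, hcnt, lam, i₀, fun i => ⟨hlam0 i, hle i⟩, hL0, hS.summable, hZ, hHopf, hdecay⟩

end Spectral

end WilsonFinTorusHopf

end Literature.MathematicalPhysics.QuantumFieldTheory

end
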